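import Literature.MathematicalPhysics.QuantumFieldTheory.Balaban1983to89.B8Thm2SetupTorus
import Literature.MathematicalPhysics.QuantumFieldTheory.Balaban1983to89.T3SectALandauChart
import HarnessLib

/-!
# `Balaban1983to89.T3B8Thm2AtMembers` — rung R3 (cell `ym3-torus`): [Balaban1985RegularSpaces] THEOREM 2 AT THE MEMBERS OF THE T³ FAMILIES,
# as ONE NAMED FACT (`def … : Prop`, D-0014 ∕ CONVENTIONS §4), in the currency of record of crux stmt-QuantumFields-19200's EX display
# (`B8Thm2SetupTorus.Thm2SetupSUAt` at the `SU(2)` Setup-torus objects `F.P K`, `k = K − n`, `η = L^{−(K−n)}`; ★★OWNER RULING g27-№2)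

WHAT.  Print: T. Bałaban, *Spaces of regular gauge field configurations on a lattice and gauge fixing conditions*, Commun. Math. Phys. **99**
(1985) 75–102 [Balaban1985RegularSpaces], THEOREM 2 p. 83: for `U₀ ∈ 𝔘_k` regular ((1.33)), `U′U₀ ∈ 𝔘_k` axial relative to `U₀` ((1.34)) with small
averages ((1.35), `α₀ + α₁ ≤ c₁`), there is exactly one gauge transformation `u` restricted by (1.29) such that `U₁ = U′^{u⁻¹} = e^{iηA}` satisfies
(1.36)–(1.39) (sup, gradient, Hölder, divergence and Laplacian bounds `B₁(α₀ + α₁)`, and the generalised Landau condition (1.38)); the constants depend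
on `d`, `L` and the geometric thresholds only (p. 77 l.8–11: «M₁ … depends on d and L only. We assume that R is a sufficiently large positive integer
(a power of L)»; [Balaban1985BackgroundPropagators] p. 408: `M = K R₀ M₀`; [Balaban1984PropagatorsII] (2.1)–(2.4) p. 224: «M is a size of big blocks
and R is a big positive integer» — print puts NO floor on the block size `L`).  Here: the all-torus geometry `Ω_j = T_η` (p. 77 «Ω_j = T_η for
j = 0, 1, …, l, l ≤ k») at EVERY member `(F, n < K)` of EVERY three-torus family `F : T3ContinuumYM3Torus.T3Family` ([Balaban1985UV3] (1)–(3) p.256: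
`d = 3`, odd block size `L > 1`, volume exponent `m`, `K` steps), gauge group `SU(2)`, `k = K − n` levels, `η = T3SectALandauChart.eta F n K = L^{−(K−n)}`,
with `B₁, c₁` UNIFORM in the members of a block size, AND WITH PRINT'S STANDING BIG-BLOCK SETTING EXPLICIT as a volume floor `k₀ ≤ F.m` per block size
(`M₁ = L^{k₀}`-cubes tile every level torus of the member; (1.3)–(1.4) p.77) — the text is the HYPOTHESIS of ym-inputs'
`Summit.….BalabanUVNodesN16Thm2SetupTorusOfCover.hThm2S_of_floorS` VERBATIM (whose conclusion is the letter `hThm2S` displayed by the EX chain of record,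
`Summit.….Prop7StubEXOfChartPiecesTwS53.stubEX_of_chartPiecesTwS53` :223), now given a NAME.

STATUS IN THE TREE (2026-08-30; recorded, not asserted here).  For every block size `L ≥ 5` the body is a THEOREM with no hypothesis (floor `k₀ = 0`):
`Summit.QuantumFields.YangMills.Theorems.Prop7Thm2SocketOfCoverForm.hThm2S_body_of_five_le` (p782708), which reads cell lit-balaban's binder-free cover form
`B8Thm2TorusCoverOfProp6DeltaA.hThm2Cover_of_prop6_deltaA (hℓ : 4 ≤ ℓ)` (p720401, `L = ℓ + 1`) through `BalabanUVNodesN16Thm2TorusOfCover.thm2TorusAt_of_dvd'`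
and `B8Thm2SetupTorus.thm2SetupSUAt_of_thm2TorusAt`; even `L` carry no member (`T3Family.hL : Odd L ∧ 1 < L`).  Hence `B8Thm2AtT3Members_holds` is OPEN EXACTLY
AT `L = 3` (`…Prop7Thm2SocketOfCoverForm.hThm2S_of_three`): lit-balaban's V1 family index `B6KLevelCensusIndexV1.KIdx` carries the FIELD `hℓ : 4 ≤ ℓ` (:94;
402 cone files) and one genuine geometric reader ([Balaban1985BackgroundPropagators] Cor. 3.6 hull `B9Cor36CutoffSecondDiff.nearH_of_nearC'`, `2ℓS ≥ 5S + 1`,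
false at `ℓ = 2`; ≈ 105 files carry `widH`∕`radH`∕`CubeSequence408`) — an `ℓ = 2` re-edition of that cone discharges this fact (19200 evidence #49∕#51,
px21 g17 LOCATE-L3; chair ★p1 g30 CARD-19200-V3-g30).

WHY A NAMED FACT.  Crux stmt-QuantumFields-19200 `UnitScaleTilt.MinimiserStabilityRegPr` is, by kernel, equivalent to its own `L = 3` instance
(`…MinimiserStabilityRegPrResidueThree.minimiserStabilityRegPr_iff_three`, p792443) and follows from this fact's `L = 3` instance alone
(`…MinimiserStabilityRegPrOfEXRowsS55.minimiserStabilityRegPr_of_thm2SS55`, p783315); naming the fact lets the gate record the closure-modulo against ONE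
Literature name instead of an anonymous hypothesis repeated across files (D-0014; ★★★ director-ym g19 «GO (iii)» 2026-08-30T22:20:33Z, ★★OWNER RULING №66).

FIDELITY TO PRINT (director's condition (C1); OWNER RULING №66 (C1-α)∕(C1-β); page∕line = printed page of CMP 99).
(α) THE REGULARITY SLOT `Reg := fun _ => True`.  Print's hypothesis (1.33) p.82 has two members: «U₀ ∈ 𝔘_k({Ω_j}, α₀), U₀ satisfies the regularity condition (3.35)
    in [4]»; the first is `InSpace k univ α₀ η U₀` inside `Thm2SetupSUAt`, the second is the abstract slot `Reg`.  PRINT ITSELF DROPS THE SECOND MEMBER: p.82 l.24–27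
    «We need the second condition in (1.33) to apply all the results of [4] … We will see later that this condition is a consequence of the first one in (1.33), so
    eventually we will drop it out of the assumptions.» and p.99 l.16–20 «… hence for α₀ sufficiently small we have proved the regularity condition (3.35). This implies
    that we can drop out this condition from the assumption (1.33).» (= PROPOSITION 6, p.99).  So Theorem 2 WITH `Reg := ⊤` is Theorem 2 as print finally states it
    (p.83 + p.99), not a strengthening.  In the tree [B8] Prop. 6 at the all-torus data is an UNCONDITIONAL theorem at every odd `L ≥ 3`:
    `B8Prop6PrintedZdCubPGammaL3.prop6At_bgZd_allTorus_holds_L3 (hd2 : 2 ≤ d) (hL3 : 3 ≤ L) (hodd : Odd L)` (and `B8Prop6Reg335ZdAllTorus.prop6At_bgZd_allTorus_holds`,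
    odd `L ≥ 5`), which is exactly how the `L ≥ 5` theorem of this fact's body (lit-balaban EIGHTH cover form, (Gₛ)∕(Cₛ) discharged from Prop. 6) reaches the `⊤` slot.
(β) BLOCK SIZES `R`, `M₁`, `M` — PRINT'S STANDING SETTING CARRIED EXPLICITLY.  p.77 (1.3)–(1.4): «Ω_j = B^j(Ω_j^{(j)}), Ω_j is a sum of cubes of a size M₁;
    (Lʲη)⁻¹dist(Ω_j^c, Ω_{j+1}) ≥ RM₁.  The number M₁ is a size of big blocks and was fixed in [4] … it depends on d and L only. We assume that R is a sufficiently
    large positive integer (a power of L)»; [4] p.408: «R, M sufficiently large … powers of L … M = K R₀M₀».  With `Ω_j = T_η` (p.77 l.21–22 «we admit the case when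
    some domains Ω_j are equal to T_η») the distance clause is void and what remains is the TILING of every level torus by big blocks `M₁ = L^{k₀}`: for the member
    `(F, n, K)` the level-`j` torus has `2·L^{m+K−j}` sites per direction (`j ≤ K − n`), so `k₀ ≤ F.m` suffices — THIS IS THE DEF's FLOOR `k₀ ≤ F.m` (`∃ k₀` after
    `L`, since `M₁ = M₁(d, L)`).  `B₁, c₁` are L-dependent constants (p.83), hence `∃ B₁ c₁` after `L` and before the member — print's order.  (The floor is «no
    floor» downstream: every member is served by its `L^{k₀}`-fold cover through the uniqueness clause — `Summit.….BalabanUVNodesN16Thm2SetupTorusOfCover.hThm2S_of_floorS`,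
    a tree theorem for every `L`; that corollary is NOT folded into this fact.)
(γ) QUANTIFIERS.  `∃ β₀ B₂ len` sits inside the member clause: the (1.36) Hölder member is therefore the WEAK reading of record (lit-balaban's A13
    `B8Thm2T3FamilyBinder.hThm2_of_constants` concludes with `β₀ = 0`) — `-- TODO(general form): print fixes 0 < β₀ < 1 and B₂(β₀) before the member`; this makes
    the fact WEAKER than p.83, never stronger.  No block-size floor: print states Theorem 2 for every integer `L > 1` (negative sweep of CMP 95∕96∕98∕99∕102 by
    ym3-torus-lit g31, 2026-08-30T22:25:55Z: «odd», «> 11» occur in [Balaban1987RG1] §0 only).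

HONEST SCOPE.  A DEFINITION (a `Prop`) + its `Iff.rfl` unfolding, asserted by nothing; no `sorry`, no `axiom`, no `instance`, no `notation`; Literature-pure imports;
the vacuity ∕ odd-block-size bookkeeping and every consumer live under `Summits/…/Theorems/` (p1 g30 `UnitScaleTiltMinimiserStabilityRegPrOfB8Thm2AtT3Members`).  Rung R3 = SU(2) YM₃ on
T³ — NOT d = 4, NOT infinite volume, NOT a mass gap, NOT Clay; the Yang–Mills mass gap is NOT proved.
-/

namespace Literature.MathematicalPhysics.QuantumFieldTheory.Balaban1983to89.T3B8Thm2AtMembers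

open T3ContinuumYM3Torus (T3Family)
open B8Thm2SetupTorus (Thm2SetupSUAt)
open T3SectALandauChart (eta)

/-- **[Balaban1985RegularSpaces] THEOREM 2 AT THE MEMBERS OF THE T³ FAMILIES** (named fact, print's standing big-block setting EXPLICIT): for every block
size `L > 1` there are a big-block exponent `k₀` (print's `M₁ = M₁(d, L)`, a power of `L`, p.77 l.8–11) and constants `B₁, c₁ > 0` (p.83: «There exist constants
B₁, B₂(β₀), c₁ …», «depending on d and L only») such that at every member `(F, n < K)` of every family `F : T3Family` with `F.L = L` WHOSE UNIT TORUS IS A UNION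
OF BIG BLOCKS — `k₀ ≤ F.m`, so that every level-`j` torus `T^{(j)}`, `j ≤ K − n`, with its `2·L^{m+n+(K−n−j)}` sites per direction is tiled by `L^{k₀}`-cubes (print's
(1.3)–(1.4) p.77 «Ω_j is a sum of cubes of a size M₁» with `Ω_j = T_η`, the distance clause being void) — [B8] Thm 2 holds at the `SU(2)` Setup-torus object `F.P K`
with `k = K − n` levels, `η = L^{−(K−n)}`, all-torus geometry, regularity slot dropped (p.82∕p.99, see the module docstring (α)): existence AND uniqueness of the
(1.29)-restricted gauge transformation with (1.36)–(1.39), i.e. `B8Thm2SetupTorus.Thm2SetupSUAt (F.P K) 2 (K − n) η β₀ B₁ B₂ c₁ len (fun _ => True)` for some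
`β₀ B₂ len`.  The text is the HYPOTHESIS of `Summit.….BalabanUVNodesN16Thm2SetupTorusOfCover.hThm2S_of_floorS` VERBATIM (the floor shape agreed between
lit-balaban's A14 `B8Thm2TorusKnitCubeCore.hThm2_of_core` and ym-inputs: «a volume floor is no floor» — every member is served by its `L^{k₀}`-fold cover through
the uniqueness clause).  Status: a theorem for every `L ≥ 5` (`Summit.….Prop7Thm2SocketOfCoverForm.hThm2S_body_of_five_le`, `k₀ = 0`); OPEN at `L = 3`
(lit-balaban `KIdx.hℓ : 4 ≤ ℓ`).  `-- TODO(general form): every torus tiled by big blocks (not only the sides 2·Lʲ of the T³ programme), any d ≥ 2, any SU(N),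
a Hölder exponent 0 < β₀ < 1 fixed before the member.` [cite: Balaban1985RegularSpaces, Thm 2 p.83] -/
def B8Thm2AtT3Members : Prop :=
  ∀ (L : ℕ), 1 < L → ∃ (k₀ : ℕ) (B₁ c₁ : ℝ), 0 < B₁ ∧ 0 < c₁ ∧ ∀ (F : T3Family), F.L = L → k₀ ≤ F.m → ∀ (n K : ℕ), n < K →
    ∃ (β₀ B₂ : ℝ) (len : B7Prop1Explicit.Site (F.P K).d → ℝ),
      Thm2SetupSUAt (F.P K) 2 (K - n) (eta F n K) β₀ B₁ B₂ c₁ len (fun _ => True)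

/-- Unfolding (bookkeeping for consumers that display the text). [cite: Balaban1985RegularSpaces, Thm 2 p.83] -/
theorem b8Thm2AtT3Members_iff :
    B8Thm2AtT3Members ↔
      ∀ (L : ℕ), 1 < L → ∃ (k₀ : ℕ) (B₁ c₁ : ℝ), 0 < B₁ ∧ 0 < c₁ ∧ ∀ (F : T3Family), F.L = L → k₀ ≤ F.m → ∀ (n K : ℕ), n < K →
        ∃ (β₀ B₂ : ℝ) (len : B7Prop1Explicit.Site (F.P K).d → ℝ),
          Thm2SetupSUAt (F.P K) 2 (K - n) (eta F n K) β₀ B₁ B₂ c₁ len (fun _ => True) :=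
  Iff.rfl

end Literature.MathematicalPhysics.QuantumFieldTheory.Balaban1983to89.T3B8Thm2AtMembers
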